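import Literature.NumberTheory.PAdicHodge.TateH1LineOverF
import Literature.NumberTheory.PAdicHodge.TateTwistedH1Vanishing
import Literature.NumberTheory.PAdicHodge.TateSenConditionCompletedAlgClosure
import HarnessLib

/-!
# Tate 1967 §3.3 Theorems 1–2 over `F` from `H¹_cont(ker χ, ℂ_F) = 0`, and BY NAME from the (TS1) fact

The files `TateH1LogChiLine`, `TateH1LineOverF`, `TateTwistedH1Vanishing` prove Tate's `H¹` theorems
(`H¹_cont(Γ_F, ℂ_F) = F · [log χ_F]`, `H¹_cont(Γ_F, ℂ_F(χ_F^j)) = 0` for `j ≠ 0`) GRANTED the Tate–Sen axiom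
(TS1) in the raw binder shape `hTS` of `TateSen.baseKer_exists_eq_smul_sub_of_TS1` (edix-p4). The ONLY use of
(TS1) there is Tate's Prop. 10: **`H¹_cont(H₀, ℂ_F) = 0` for `H₀ = ker χ ≤ G₀ = Gal(F̄/K₀)`**. This file
re-keys the theorems on that cohomological statement itself (hypothesis `hH0`, any proof of it plugs in) and
then BY NAME on the tree's cite-only fact `tate1967_TS1_completedAlgClosure` (Berger–Colmez 2008 Déf. 3.1.3 +
Prop. 4.1.1, file `TateSenConditionCompletedAlgClosure`, whose corollary `baseKer_exists_eq_smul_sub` is `hH0`):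

* `TateH1.exists_eq_mul_logChi_add_coboundary_of_kerVanishing` (`G₀`-line),
  `TateH1.exists_eq_coboundary_add_mul_logCyclotomic_of_kerVanishing`,
  `TateH1.existsUnique_coeff_logCyclotomic_of_kerVanishing` (Theorem 1 over `F`);
* `TateTwistedH1.exists_eq_tcoboundary_of_kerVanishing` (`G₀`),
  `TateTwistedH1.exists_eq_tcoboundary_absGalois_of_kerVanishing` (Theorem 2 over `F`, `j ≠ 0`);
* **`TateH1.existsUnique_coeff_logCyclotomic_of_TS1fact`**, **`TateTwistedH1.exists_eq_tcoboundary_absGalois_of_TS1fact`**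
  — Tate 1967 §3.3 Theorems 1–2 (their `H¹` parts) for the `p`-adic field `F`, CONDITIONAL on the single named
  fact `tate1967_TS1_completedAlgClosure` and nothing else.

No new named fact, no `sorry`, no definition.

## References
* J. Tate, *p-divisible groups* (1967), §3.2 Prop. 10, §3.3 Theorems 1–2. [Tate1967]
* L. Berger, P. Colmez, *Familles de représentations de de Rham et monodromie p-adique* (2008), Déf. 3.1.3, Prop. 4.1.1. [BergerColmez2008]
* J.-M. Fontaine, Y. Ouyang, *Theory of p-adic Galois representations*, §3.2 Thm. 3.21. [FontaineOuyang2022]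
-/

noncomputable section

open ValuativeRel Field UniformSpace Filter Topology

namespace Literature.NumberTheory.PAdicHodge

open Literature.NumberTheory.GaloisRepresentations
open Literature.NumberTheory.GaloisRepresentations.IsNonarchimedeanLocalField
open CyclotomicTower TateTrace

variable {F : Type} [Field F] [ValuativeRel F] [TopologicalSpace F] [IsNonarchimedeanLocalField F]
  [CharZero F] {p : ℕ} [Fact p.Prime] (hp : valuation F p < 1)

namespace TateH1

variable {f : BaseGaloisGroup hp → CompletedAlgClosure F}

/-- **`H¹_cont(G₀, ℂ_F) = ℚ_p · log χ` from `H¹_cont(ker χ, ℂ_F) = 0`**: every continuous `1`-cocycle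
`f : G₀ → ℂ_F` is `ι(c · log χ) + ∂b`, granted only that continuous cocycles of `H₀ = ker χ` in `ℂ_F` are
coboundaries (hypothesis `hH0`, Tate's Prop. 10). [cite: Tate1967, §3.2 Prop. 10 and §3.3 Theorem 1] -/
theorem exists_eq_mul_logChi_add_coboundary_of_kerVanishing
    (hH0 : ∀ c : (BaseGaloisGroup.baseCyclotomicCharacter hp).ker → CompletedAlgClosure F,
      (∀ g h : (BaseGaloisGroup.baseCyclotomicCharacter hp).ker, c (g * h) = c g + g • c h) → Continuous c →
        ∃ b : CompletedAlgClosure F, ∀ g : (BaseGaloisGroup.baseCyclotomicCharacter hp).ker, c g = g • b - b)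
    (hcoc : ∀ g h : BaseGaloisGroup hp, f (g * h) = f g + g • f h) (hcont : Continuous f) :
    ∃ (c : PadicBase F p hp) (b : CompletedAlgClosure F), ∀ g : BaseGaloisGroup hp,
      f g = ι hp (c * (PadicBase.toPadic hp).symm (Literature.IUT.LogVolume.unitLog
        (((BaseGaloisGroup.baseCyclotomicCharacter hp g : ℤ_[p]ˣ) : ℤ_[p]) : ℚ_[p]))) + (g • b - b) := by
  obtain ⟨b₀, hb₀⟩ := hH0 (fun h : (BaseGaloisGroup.baseCyclotomicCharacter hp).ker => f h)
    (fun g h => by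
      change f ((g : BaseGaloisGroup hp) * h) = f g + (g : BaseGaloisGroup hp) • f h
      exact hcoc g h)
    (hcont.comp continuous_subtype_val)
  set f₁ : BaseGaloisGroup hp → CompletedAlgClosure F := fun g => f g - (g • b₀ - b₀) with hf₁
  have hcoc₁ : ∀ g h : BaseGaloisGroup hp, f₁ (g * h) = f₁ g + g • f₁ h := fun g h =>
    cocycle_sub_coboundary hp hcoc b₀ g h
  have hH₁ : ∀ h : BaseGaloisGroup hp, (∀ M, h • zeta F p M = zeta F p M) → f₁ h = 0 := by
    intro h hh
    have hker : h ∈ (BaseGaloisGroup.baseCyclotomicCharacter hp).ker := by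
      rw [MonoidHom.mem_ker]; exact chi_eq_one_of_forall_smul_zeta hp hh
    have := hb₀ ⟨h, hker⟩
    change f h = h • b₀ - b₀ at this
    simp only [hf₁, this, sub_self]
  have hcont₁ : Continuous f₁ := hcont.sub ((TateSen.continuous_base_smul_left hp b₀).sub continuous_const)
  obtain ⟨c, b, hb⟩ := exists_eq_mul_logChi_add_coboundary hp hcoc₁ hH₁ hcont₁
  refine ⟨c, b + b₀, fun g => ?_⟩
  have := hb g
  simp only [hf₁] at this
  rw [smul_add]
  linear_combination this

variable {c : absoluteGaloisGroup F → CompletedAlgClosure F}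

/-- **Tate 1967 §3.3 Theorem 1 over `F` from `H¹_cont(ker χ, ℂ_F) = 0`**: every continuous `1`-cocycle
`c : Γ_F → ℂ_F` is `σ • B − B + A · log χ_F(σ)` (`B ∈ ℂ_F`, `A ∈ F`), granted `hH0`.
[cite: Tate1967, §3.2 Prop. 10 and §3.3 Theorem 1] [cite: FontaineOuyang2022, §3.2 Thm. 3.21] -/
theorem exists_eq_coboundary_add_mul_logCyclotomic_of_kerVanishing
    (hH0 : ∀ c : (BaseGaloisGroup.baseCyclotomicCharacter hp).ker → CompletedAlgClosure F,
      (∀ g h : (BaseGaloisGroup.baseCyclotomicCharacter hp).ker, c (g * h) = c g + g • c h) → Continuous c →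
        ∃ b : CompletedAlgClosure F, ∀ g : (BaseGaloisGroup.baseCyclotomicCharacter hp).ker, c g = g • b - b)
    (hc : ∀ σ τ : absoluteGaloisGroup F, c (σ * τ) = c σ + σ • c τ) (hcont : Continuous c) :
    ∃ (B : CompletedAlgClosure F) (A : F), ∀ σ : absoluteGaloisGroup F,
      c σ = σ • B - B + algebraMap F (CompletedAlgClosure F) A *
        algebraMap F (CompletedAlgClosure F) (LocalField.padicRingHom F p hp (logCyclotomic p σ)) := by
  have hc' : ∀ σ τ : absoluteGaloisGroup F,
      c (σ * τ) = c σ + ι hp (TateDescent.W hp (BaseGaloisGroup.toBase hp σ)) ^ (0 : ℤ) * (σ • c τ) :=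
    fun σ τ => by rw [zpow_zero, one_mul]; exact hc σ τ
  have hmul : ∀ x y : PadicBase F p hp, ι hp (x * y) = ι hp x * ι hp y := fun x y => map_mul (ιHom hp) x y
  obtain ⟨B, A, h⟩ := TateDescent.exists_eq_twistedCoboundary_of_base hp 0
    (fun g => ι hp ((PadicBase.toPadic hp).symm (Literature.IUT.LogVolume.unitLog
      (((BaseGaloisGroup.baseCyclotomicCharacter hp g : ℤ_[p]ˣ) : ℤ_[p]) : ℚ_[p]))))
    (fun C hC hCc => by
      have hCoc : ∀ g g' : BaseGaloisGroup hp, C (g * g') = C g + g • C g' := fun g g' => by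
        simpa only [zpow_zero, one_mul] using hC g g'
      obtain ⟨a, b, hb⟩ := exists_eq_mul_logChi_add_coboundary_of_kerVanishing hp hH0 hCoc hCc
      exact ⟨b, a, fun g => by rw [hb g, zpow_zero, one_mul, hmul]; ring⟩)
    hc' hcont
  refine ⟨B, A, fun σ => ?_⟩
  rw [h σ, zpow_zero, one_mul, ι_logChi_toBase]

/-- **`H¹_cont(Γ_F, ℂ_F) ≅ F` on the class of `log χ_F`, from `H¹_cont(ker χ, ℂ_F) = 0`**: every continuous
`1`-cocycle `c : Γ_F → ℂ_F` determines a UNIQUE `A ∈ F` with `c = ∂B + A · log χ_F`.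
[cite: Tate1967, §3.3 Theorem 1] -/
theorem existsUnique_coeff_logCyclotomic_of_kerVanishing
    (hH0 : ∀ c : (BaseGaloisGroup.baseCyclotomicCharacter hp).ker → CompletedAlgClosure F,
      (∀ g h : (BaseGaloisGroup.baseCyclotomicCharacter hp).ker, c (g * h) = c g + g • c h) → Continuous c →
        ∃ b : CompletedAlgClosure F, ∀ g : (BaseGaloisGroup.baseCyclotomicCharacter hp).ker, c g = g • b - b)
    (hc : ∀ σ τ : absoluteGaloisGroup F, c (σ * τ) = c σ + σ • c τ) (hcont : Continuous c) :
    ∃! A : F, ∃ B : CompletedAlgClosure F, ∀ σ : absoluteGaloisGroup F,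
      c σ = σ • B - B + algebraMap F (CompletedAlgClosure F) A *
        algebraMap F (CompletedAlgClosure F) (LocalField.padicRingHom F p hp (logCyclotomic p σ)) := by
  obtain ⟨B, A, h⟩ := exists_eq_coboundary_add_mul_logCyclotomic_of_kerVanishing hp hH0 hc hcont
  exact ⟨A, ⟨B, h⟩, fun A' ⟨B', h'⟩ => coeff_logCyclotomic_unique hp h' h⟩

/-- **Tate 1967 §3.3 Theorem 1 (`H¹` part) for the `p`-adic field `F`, BY NAME from the (TS1) fact**:
`H¹_cont(Γ_F, ℂ_F) ≅ F` on `[log χ_F]` — every continuous `1`-cocycle `c : Γ_F → ℂ_F` is `∂B + A · log χ_F`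
for a UNIQUE `A ∈ F`. CONDITIONAL on the cite-only named fact `tate1967_TS1_completedAlgClosure`
(Berger–Colmez (TS1) for `ℂ_F`; its corollary `baseKer_exists_eq_smul_sub` is Tate's Prop. 10) and nothing else.
[cite: Tate1967, §3.3 Theorem 1] [cite: BergerColmez2008, Déf. 3.1.3 and Prop. 4.1.1] -/
theorem existsUnique_coeff_logCyclotomic_of_TS1fact (hTS1 : tate1967_TS1_completedAlgClosure)
    (hc : ∀ σ τ : absoluteGaloisGroup F, c (σ * τ) = c σ + σ • c τ) (hcont : Continuous c) :
    ∃! A : F, ∃ B : CompletedAlgClosure F, ∀ σ : absoluteGaloisGroup F,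
      c σ = σ • B - B + algebraMap F (CompletedAlgClosure F) A *
        algebraMap F (CompletedAlgClosure F) (LocalField.padicRingHom F p hp (logCyclotomic p σ)) :=
  existsUnique_coeff_logCyclotomic_of_kerVanishing hp
    (fun c hc hcont => baseKer_exists_eq_smul_sub hTS1 hp c hc hcont) hc hcont

end TateH1

namespace TateTwistedH1

variable {j : ℤ} {C : BaseGaloisGroup hp → CompletedAlgClosure F}

/-- **`H¹_cont(G₀, ℂ_F(χ^j)) = 0` (`j ≠ 0`) from `H¹_cont(ker χ, ℂ_F) = 0`**: every continuous `χ^j`-twisted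
`1`-cocycle of `G₀` is a twisted coboundary, granted `hH0`. [cite: Tate1967, §3.2 Prop. 10 and §3.3 Theorem 2] -/
theorem exists_eq_tcoboundary_of_kerVanishing
    (hH0 : ∀ c : (BaseGaloisGroup.baseCyclotomicCharacter hp).ker → CompletedAlgClosure F,
      (∀ g h : (BaseGaloisGroup.baseCyclotomicCharacter hp).ker, c (g * h) = c g + g • c h) → Continuous c →
        ∃ b : CompletedAlgClosure F, ∀ g : (BaseGaloisGroup.baseCyclotomicCharacter hp).ker, c g = g • b - b)
    (hj : j ≠ 0)
    (hC : ∀ g g' : BaseGaloisGroup hp, C (g * g') = C g + ι hp (TateDescent.W hp g) ^ j * (g • C g'))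
    (hcont : Continuous C) :
    ∃ b : CompletedAlgClosure F, ∀ g : BaseGaloisGroup hp, C g = ι hp (TateDescent.W hp g) ^ j * (g • b) - b := by
  obtain ⟨b₀, hb₀⟩ := hH0 (fun h : (BaseGaloisGroup.baseCyclotomicCharacter hp).ker => C h)
    (fun g h => by
      change C ((g : BaseGaloisGroup hp) * h) = C g + (g : BaseGaloisGroup hp) • C h
      rw [hC, ι_W_zpow_eq_one_of_mem_ker hp g.2, one_mul])
    (hcont.comp continuous_subtype_val)
  set C₁ : BaseGaloisGroup hp → CompletedAlgClosure F :=
    fun g => C g - (ι hp (TateDescent.W hp g) ^ j * (g • b₀) - b₀) with hC₁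
  have hC₁coc : ∀ g g' : BaseGaloisGroup hp,
      C₁ (g * g') = C₁ g + ι hp (TateDescent.W hp g) ^ j * (g • C₁ g') := fun g g' =>
    tcocycle_sub_tcoboundary hp hC b₀ g g'
  have hC₁H : ∀ h : BaseGaloisGroup hp, (∀ M, h • zeta F p M = zeta F p M) → C₁ h = 0 := by
    intro h hh
    have hker : h ∈ (BaseGaloisGroup.baseCyclotomicCharacter hp).ker := by
      rw [MonoidHom.mem_ker]; exact chi_eq_one_of_forall_smul_zeta hp hh
    have := hb₀ ⟨h, hker⟩
    change C h = h • b₀ - b₀ at this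
    simp only [hC₁, this, ι_W_zpow_eq_one_of_forall_smul_zeta hp hh, one_mul, sub_self]
  obtain ⟨y, -, hy⟩ := eq_tcoboundary_of_forall_smul_zeta hp hj hC₁coc hC₁H
  refine ⟨y + b₀, fun g => ?_⟩
  have := hy g
  simp only [hC₁] at this
  rw [smul_add, mul_add]
  linear_combination this

variable {c : absoluteGaloisGroup F → CompletedAlgClosure F}

/-- **Tate 1967 §3.3 Theorem 2 over `F` from `H¹_cont(ker χ, ℂ_F) = 0`**: `H¹_cont(Γ_F, ℂ_F(χ_F^j)) = 0` for
`j ≠ 0` — every continuous `χ_F^j`-twisted cocycle on `Γ_F` is a twisted coboundary, granted `hH0`.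
[cite: Tate1967, §3.2 Prop. 10 and §3.3 Theorem 2] -/
theorem exists_eq_tcoboundary_absGalois_of_kerVanishing
    (hH0 : ∀ c : (BaseGaloisGroup.baseCyclotomicCharacter hp).ker → CompletedAlgClosure F,
      (∀ g h : (BaseGaloisGroup.baseCyclotomicCharacter hp).ker, c (g * h) = c g + g • c h) → Continuous c →
        ∃ b : CompletedAlgClosure F, ∀ g : (BaseGaloisGroup.baseCyclotomicCharacter hp).ker, c g = g • b - b)
    (hj : j ≠ 0)
    (hc : ∀ σ τ : absoluteGaloisGroup F,
      c (σ * τ) = c σ + ι hp (TateDescent.W hp (BaseGaloisGroup.toBase hp σ)) ^ j * (σ • c τ))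
    (hcont : Continuous c) :
    ∃ B : CompletedAlgClosure F, ∀ σ : absoluteGaloisGroup F,
      c σ = ι hp (TateDescent.W hp (BaseGaloisGroup.toBase hp σ)) ^ j * (σ • B) - B := by
  obtain ⟨B, A, h⟩ := TateDescent.exists_eq_twistedCoboundary_of_base hp j (fun _ => 0)
    (fun C hC hCc => by
      obtain ⟨b, hb⟩ := exists_eq_tcoboundary_of_kerVanishing hp hH0 hj hC hCc
      exact ⟨b, 0, fun g => by rw [hb g, mul_zero, add_zero]⟩)
    hc hcont
  exact ⟨B, fun σ => by rw [h σ, mul_zero, add_zero]⟩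

/-- **Tate 1967 §3.3 Theorem 2 (`H¹` part) for the `p`-adic field `F`, BY NAME from the (TS1) fact**:
`H¹_cont(Γ_F, ℂ_F(χ_F^j)) = 0` for `j ≠ 0` (weight `χ_F(σ)^j` read in `ℂ_F` through `ℤ_p → ℚ_p → F → ℂ_F`).
CONDITIONAL on the cite-only named fact `tate1967_TS1_completedAlgClosure` and nothing else.
[cite: Tate1967, §3.3 Theorem 2] [cite: BergerColmez2008, Déf. 3.1.3 and Prop. 4.1.1] -/
theorem exists_eq_tcoboundary_absGalois_of_TS1fact (hTS1 : tate1967_TS1_completedAlgClosure) (hj : j ≠ 0)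
    (hc : ∀ σ τ : absoluteGaloisGroup F,
      c (σ * τ) = c σ + algebraMap F (CompletedAlgClosure F) (LocalField.padicRingHom F p hp
        (((GaloisRep.cyclotomicCharacter F p σ : ℤ_[p]ˣ) : ℤ_[p]) : ℚ_[p])) ^ j * (σ • c τ))
    (hcont : Continuous c) :
    ∃ B : CompletedAlgClosure F, ∀ σ : absoluteGaloisGroup F,
      c σ = algebraMap F (CompletedAlgClosure F) (LocalField.padicRingHom F p hp
        (((GaloisRep.cyclotomicCharacter F p σ : ℤ_[p]ˣ) : ℤ_[p]) : ℚ_[p])) ^ j * (σ • B) - B := by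
  simp only [← ι_W_toBase hp] at hc ⊢
  exact exists_eq_tcoboundary_absGalois_of_kerVanishing hp
    (fun c hc hcont => baseKer_exists_eq_smul_sub hTS1 hp c hc hcont) hj hc hcont

end TateTwistedH1

end Literature.NumberTheory.PAdicHodge

end
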